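import Summits.BirchSwinnertonDyer.BirchSwinnertonDyer.Theorems.GenusKolyvaginAtTwoGenusPrimitiveSupplyAtTwoGenusComponents
import Literature.NumberTheory.EllipticCurves.RingClassFieldGenusDiscriminantProofs
import Literature.NumberTheory.EllipticCurves.HeegnerPointsOfConductorOneData

/-!
# Route `GenusKolyvaginAtTwo`, crux stmt-BirchSwinnertonDyer-24947 `MultiGenusPrimitivityAtTwo` (U): the DISCRIMINANT-GENUS
# SHADOWS of the certificate — `Z ≡ Z_χ (mod 2E(K[n]))` for every genus character `χ` of `K`, unconditionally

Lead prover seat bsd-line-gk2-p1 (g4). Helper (`--supports stmt-BirchSwinnertonDyer-24947`); no summit, leaf or crux is proved;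
BSD is not proved by any of this.

THE OBSERVATION. U's certificate at level `n` is «`Z := Σ_{g ∈ T} g·y(n) ∉ 2E(K[n])`» for a finite set `T` of automorphisms of
`K[n]` (the stabiliser of the conductor radicals `√ℓ*`, `ℓ ∣ n`). For ANY sign function `ε : T → {±1}`,
`Z − Σ_{g∈T} ε(g)·g·y = 2·Σ_{ε(g) = −1} g·y ∈ 2E(K[n])` (§1) — so `Z ∈ 2E(K[n]) ⟺ Σ_g ε(g) g·y ∈ 2E(K[n])`. Take for `ε` a
GENUS CHARACTER OF `K`: for an odd prime `q ∣ d_K` the radical `ϑ_q = √q*` lies in the Hilbert class field `K[1] ⊆ K[n]`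
(Gauss's genus theory, tree theorem `sqrt_primeStar_mem_ringClassField_one`, Cox Thm. 6.1; §2), every automorphism moves it to
`±ϑ_q`, and `χ_Q(g) := ∏_{q ∈ Q} (gϑ_q/ϑ_q)` (`Q` any set of odd primes of `d_K`) is a character on any subgroup. Hence (§3):

  **`Z ∈ 2E(K[n]) ⟺ Z_{χ_Q} := Σ_{g∈T} χ_Q(g)·g·y(n) ∈ 2E(K[n])`, for every `Q ⊆ {odd primes of d_K}`,**

and `Z_{χ_Q}` is `χ_Q`-ISOTYPIC for the subgroup `T` enumerates (§3): up to the twist isomorphism it is the corresponding trace of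
the image of `y(n)` on the GENUS TWIST `E^{(Q*)}`, `Q* = ∏_{q∈Q} q*` (`E^{(Q*)} ≅ E^{(Q*·d_K)}` over `K`). So the `2`-primitivity
certificate of U is not a property of `E` alone but of the whole genus class `{E^{(Q*)} : Q}` over `K`: a certificate for `(E, K, n, T)`
is verbatim a certificate for each of the `2^t` shadows (`t + 1` = number of prime factors of `d_K`; `χ_{all} = 1` on `Gal(K[n]/K)`).
At level `1` (§4): `M₀ = 0` (the hypothesis of the landed `stub_levelOne`, p605391) forces EVERY genus Heegner point
`y_{χ_Q} = Σ_{g ∈ Gal(K[1]/K)} χ_Q(g) g·y(1)` to be `2`-indivisible in `E(K[1])`, hence of INFINITE ORDER (`E(K[1])` has no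
`2`-torsion on the habitat, `GenusKoly.heegner_two_torsion_free`); by Gross–Zagier for genus characters this says that every genus pair
`(E^{(Q*)}, E^{(Q* d_K)})` has analytic ranks exactly `{0, 1}` — an unconditional NECESSARY condition for U's level-`1` certificate,
and the structural reason behind the cell's BSD-side count `DEF(E,K) = Σ_{q∣d_K} dim Ẽ(𝔽_q)[2] + [Δ>0]` (U-LEDGER (♥)/(♣), REPAIR
CENSUS v1.2 §6): the transposition primes `q ∣ d_K` are exactly where twisting by `q*` moves the `2`-Selmer rank (Mazur–Rubin), i.e.
where a genus shadow can acquire excess rank / Ш[2] and force `2`-divisibility of ALL shadows at once.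
References: Birch 1970 / Gross 1984 §§ on genus characters of Heegner points (the congruence `y_K ≡ y_χ (mod 2)` is the classical
«Birch lemma» device); Cox 2013 Thm. 6.1 (genus field ⊆ Hilbert class field).
-/

set_option linter.dupNamespace false -- tree convention: `Summit.BirchSwinnertonDyer.BirchSwinnertonDyer.Theorems` (D-0017)

noncomputable section

open scoped Classical

namespace Summit.BirchSwinnertonDyer.BirchSwinnertonDyer.Theorems.GenusKoly

open Finset NumberField WeierstrassCurve Literature.NumberTheory.EllipticCurves
  Literature.NumberTheory.EllipticCurves.ModularForms

/-! ## §1 Abstract: an orbit sum and any of its sign-twists agree mod `2` -/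

section Abstract

variable {𝒢 : Type*} [Monoid 𝒢] {A : Type*} [AddCommGroup A] (act : 𝒢 →* AddMonoid.End A)

/-- **`Σ_{g∈T} g·y = Σ_{g∈T} ε(g)·g·y + 2·R`** for any finite `T` and any signs `ε(g) ∈ {±1}` (`R = Σ_{ε(g)=−1} g·y`). [folklore] -/
theorem exists_sum_act_eq_signSum_add_two_smul (T : Finset 𝒢) (ε : 𝒢 → ℤ) (hε : ∀ g ∈ T, ε g = 1 ∨ ε g = -1) (y : A) :
    ∃ R : A, ∑ g ∈ T, act g y = ∑ g ∈ T, ε g • act g y + (2 : ℤ) • R := by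
  refine ⟨∑ g ∈ T.filter (fun g ↦ ε g = -1), act g y, ?_⟩
  rw [Finset.sum_filter, Finset.smul_sum, ← Finset.sum_add_distrib]
  refine Finset.sum_congr rfl fun g hg ↦ ?_
  rcases hε g hg with h | h
  · rw [h, one_smul, if_neg (by norm_num), smul_zero, add_zero]
  · rw [h, if_pos rfl, neg_one_zsmul, two_smul]
    abel

/-- **`Σ_{g∈T} g·y ∈ 2A ⟺ Σ_{g∈T} ε(g)·g·y ∈ 2A`** for any signs `ε(g) ∈ {±1}`. [folklore] -/
theorem exists_two_smul_eq_sum_iff_signSum (T : Finset 𝒢) (ε : 𝒢 → ℤ) (hε : ∀ g ∈ T, ε g = 1 ∨ ε g = -1) (y : A) :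
    (∃ Q : A, (2 : ℤ) • Q = ∑ g ∈ T, act g y) ↔ ∃ Q : A, (2 : ℤ) • Q = ∑ g ∈ T, ε g • act g y := by
  obtain ⟨R, hR⟩ := exists_sum_act_eq_signSum_add_two_smul act T ε hε y
  constructor
  · rintro ⟨Q, hQ⟩
    exact ⟨Q - R, by rw [smul_sub, hQ, hR, add_sub_cancel_right]⟩
  · rintro ⟨Q, hQ⟩
    exact ⟨Q + R, by rw [smul_add, hQ, hR]⟩

/-- A product of signs `∏_{q∈Q} (±1)` is `±1`. [folklore] -/
theorem prod_ite_eq_one_or_eq_neg_one (Q : Finset ℕ) (fix : ℕ → Prop) [∀ q, Decidable (fix q)] :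
    (∏ q ∈ Q, (if fix q then (1 : ℤ) else -1)) = 1 ∨ (∏ q ∈ Q, (if fix q then (1 : ℤ) else -1)) = -1 := by
  induction Q using Finset.induction_on with
  | empty => exact Or.inl (by simp)
  | insert a s ha ih =>
    rw [Finset.prod_insert ha]
    rcases ih with h | h <;> by_cases hfa : fix a <;> simp [h, hfa]

/-- **In a group without `2`-torsion, a point of finite order is `2`-divisible** (its order `m = 2^k m'` has `m' • Y = 0` with `m'`
odd, and `(2j+1)•Y = 0` gives `Y = 2•(−j•Y)`). [folklore] -/
theorem exists_two_smul_eq_of_isOfFinAddOrder (htors : ∀ Q : A, (2 : ℤ) • Q = 0 → Q = 0) {Y : A} (hY : IsOfFinAddOrder Y) :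
    ∃ P : A, (2 : ℤ) • P = Y := by
  obtain ⟨m, hm, hmY⟩ := hY.exists_nsmul_eq_zero
  obtain ⟨k, m', hm', hmk⟩ := Nat.exists_eq_two_pow_mul_odd hm.ne'
  have h2 : ((2 : ℕ) : ℤ) = 2 := by norm_num
  have hm'Y : m' • Y = 0 := by
    apply eq_zero_of_two_pow_smul_eq_zero htors k
    rw [← natCast_zsmul, smul_smul]
    have : (2 : ℤ) ^ k * (m' : ℤ) = ((m : ℕ) : ℤ) := by rw [hmk]; push_cast; ring
    rw [this, natCast_zsmul, hmY]
  obtain ⟨j, hj⟩ := hm'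
  refine ⟨-(j • Y), ?_⟩
  rw [hj, add_smul, one_smul, mul_smul] at hm'Y
  rw [smul_neg, ← h2, natCast_zsmul]
  exact neg_eq_of_add_eq_zero_right hm'Y

end Abstract

/-! ## §2 The discriminant radicals `ϑ_q = √q*` (`q ∣ d_K` odd) lie in every `K[n]` -/

section Radicals

variable {K : Type} [Field K] [NumberField K]

/-- **Genus theory: `√q* ∈ K[n]` for every odd prime `q ∣ d_K` and every level `n ≥ 1`** (`K[1] ⊆ K[n]`; Cox Thm. 6.1: the genus
field `K(√q₁*, …)` is inside the Hilbert class field `K[1]`; tree theorems `sqrt_primeStar_mem_ringClassField_one`, `ringClassField_mono`).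
So radicals `ϑ : ℕ → K[n]` with `ϑ_q² = q* = (−1)^{(q−1)/2} q` for all odd `q ∣ d_K` exist. [cite: Cox2013, §6.A Thm. 6.1 and §11.A Thm. 11.1] -/
theorem heegner_exists_discrRadicals (hK : IsImaginaryQuadratic K) (ι : K →+* ℂ) {n : ℕ} (hn : n ≠ 0) :
    ∃ ϑ : ℕ → ringClassField K ι n, ∀ q ∈ (NumberField.discr K).natAbs.primeFactors, q ≠ 2 →
      ϑ q ^ 2 = algebraMap ℚ (ringClassField K ι n) ((-1 : ℚ) ^ (q / 2) * q) := by
  have hle : ringClassField K ι 1 ≤ ringClassField K ι n := ringClassField_mono hK ι (one_dvd n) hn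
  -- a complex square root of `q*` for each `q`
  have hroot : ∀ q : ℕ, ∃ r : ℂ, r ^ 2 = ((((-1 : ℤ) ^ (q / 2) * q : ℤ)) : ℂ) :=
    fun q ↦ IsAlgClosed.exists_pow_nat_eq _ two_pos
  choose r hr using hroot
  have hmem : ∀ q ∈ (NumberField.discr K).natAbs.primeFactors, q ≠ 2 → r q ∈ ringClassField K ι n := by
    intro q hq hq2
    have hqp : q.Prime := Nat.prime_of_mem_primeFactors hq
    have hqD : (q : ℤ) ∣ NumberField.discr K := Int.ofNat_dvd_left.mpr (Nat.dvd_of_mem_primeFactors hq)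
    exact hle (sqrt_primeStar_mem_ringClassField_one hK ι hqp hq2 hqD (r q) (hr q))
  refine ⟨fun q ↦ if h : q ∈ (NumberField.discr K).natAbs.primeFactors ∧ q ≠ 2 then ⟨r q, hmem q h.1 h.2⟩ else 0,
    fun q hq hq2 ↦ ?_⟩
  dsimp only
  rw [dif_pos ⟨hq, hq2⟩]
  apply Subtype.ext
  have h1 : (((⟨r q, hmem q hq hq2⟩ : ringClassField K ι n) ^ 2 : ringClassField K ι n) : ℂ) = r q ^ 2 := by
    simp
  rw [h1, hr q]
  simp

end Radicals

/-! ## §3 The shadow equivalence and the isotypy of the shadows, at any level -/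

section Heegner

variable {W : WeierstrassCurve ℚ} [NeZero (W.conductorNorm ℤ)] {K : Type} [Field K] [NumberField K]
  {Dt : ModularParametrizationData W (W.conductorNorm ℤ)} {β : ℤ} {ι : K →+* ℂ}

omit [NeZero (W.conductorNorm ℤ)] in
/-- **THE DISCRIMINANT-GENUS SHADOWS OF THE CERTIFICATE.** At any level `n`, for ANY finite set `T` of automorphisms of `K[n]`, any
point `y ∈ E(K[n])`, any finite index set `Q` and any elements `ϑ_q ∈ K[n]`:
`Σ_{g∈T} g·y ∈ 2E(K[n]) ⟺ Σ_{g∈T} χ_Q(g)·g·y ∈ 2E(K[n])`, `χ_Q(g) = ∏_{q∈Q} (±1 according as g ϑ_q = ϑ_q)`.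
With `T` the genus stabiliser of U, `y = y(n)` and `ϑ_q = √q*` (`q ∣ d_K`, §2) the left side is U's certificate clause and the right side
its `χ_Q`-shadow on the genus twist `E^{(Q*)}`. Pure algebra (§1): no hypothesis on `T`, `ϑ`, `W` or `K`. [folklore] -/
theorem heegner_exists_two_zsmul_eq_sum_iff_discrShadow {n : ℕ}
    (T : Finset (ringClassField K ι n ≃ₐ[ℚ] ringClassField K ι n)) (y : (W.baseChange (ringClassField K ι n)).toAffine.Point)
    (Q : Finset ℕ) (ϑ : ℕ → ringClassField K ι n) :
    (∃ P : (W.baseChange (ringClassField K ι n)).toAffine.Point, (2 : ℤ) • P =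
        ∑ g ∈ T, pointGalHom W (ringClassField K ι n) g y) ↔
      ∃ P : (W.baseChange (ringClassField K ι n)).toAffine.Point, (2 : ℤ) • P =
        ∑ g ∈ T, (∏ q ∈ Q, (if g (ϑ q) = ϑ q then (1 : ℤ) else -1)) • pointGalHom W (ringClassField K ι n) g y :=
  exists_two_smul_eq_sum_iff_signSum (pointGalHom W (ringClassField K ι n)) T _
    (fun g _ ↦ prod_ite_eq_one_or_eq_neg_one Q (fun q ↦ g (ϑ q) = ϑ q)) y

omit [NeZero (W.conductorNorm ℤ)] in
/-- **The shadows are isotypic.** If `T` enumerates a subgroup `H` of `Aut_ℚ(K[n])` and the `ϑ_q` (`q ∈ Q`) are radicals of odd primes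
(`ϑ_q² = q*`), then for `h ∈ H`: `h · Z_{χ_Q} = χ_Q(h) · Z_{χ_Q}`, `Z_{χ_Q} = Σ_{g∈T} χ_Q(g) g·y` — the shadow lies in the
`χ_Q`-isotypic part of `E(K[n])` for `H`, i.e. (twist isomorphism over `K[n] ∋ √Q*`) it is an `H`-invariant point of the genus twist
`E^{(Q*)}`. [cite: SilvermanAEC2009, X.2 Prop. 2.4 (proof)] -/
theorem heegner_discrShadow_isotypic {n : ℕ} (H : Subgroup (ringClassField K ι n ≃ₐ[ℚ] ringClassField K ι n))
    (T : Finset (ringClassField K ι n ≃ₐ[ℚ] ringClassField K ι n)) (hT : ∀ g, g ∈ T ↔ g ∈ H)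
    (y : (W.baseChange (ringClassField K ι n)).toAffine.Point) {Q : Finset ℕ} (hQ : ∀ q ∈ Q, q.Prime)
    {ϑ : ℕ → ringClassField K ι n} (hϑ : ∀ q ∈ Q, ϑ q ^ 2 = algebraMap ℚ (ringClassField K ι n) ((-1 : ℚ) ^ (q / 2) * q))
    {h : ringClassField K ι n ≃ₐ[ℚ] ringClassField K ι n} (hh : h ∈ H) :
    pointGalHom W (ringClassField K ι n) h
        (∑ g ∈ T, (∏ q ∈ Q, (if g (ϑ q) = ϑ q then (1 : ℤ) else -1)) • pointGalHom W (ringClassField K ι n) g y) =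
      (∏ q ∈ Q, (if h (ϑ q) = ϑ q then (1 : ℤ) else -1)) •
        ∑ g ∈ T, (∏ q ∈ Q, (if g (ϑ q) = ϑ q then (1 : ℤ) else -1)) • pointGalHom W (ringClassField K ι n) g y :=
  act_component_eq_sign_smul (pointGalHom W (ringClassField K ι n)) H T hT Q (fun q g ↦ g (ϑ q) = ϑ q)
    (fun q hq h' _ g _ ↦ heegner_fix_mul_iff (hϑ q hq) (ne_zero_of_sq_eq_pStar (hQ q hq) (hϑ q hq)) h' g) y hh

/-- **U's certificate is shared by all its genus shadows** (the crux's frame). On the frame of `MultiGenusPrimitivityAtTwo` — any level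
`n`, datum `d`, conductor radicals `θ` and genus stabiliser `T` — and for every set `Q` of odd primes of `d_K` with discriminant
radicals `ϑ` (§2): `Σ_{g∈T} g·y(n) ∉ 2E(K[n]) ⟺ Σ_{g∈T} χ_Q(g) g·y(n) ∉ 2E(K[n])`. In words: a level-`n` certificate for `E` is
verbatim a level-`n` certificate for each genus twist `E^{(Q*)}`, `Q* ∣ d_K`. [folklore] -/
theorem heegner_certificate_iff_discrShadow {n : ℕ} (d : KolyvaginHeegnerData Dt β ι n)
    (T : Finset (ringClassField K ι n ≃ₐ[ℚ] ringClassField K ι n)) (Q : Finset ℕ) (ϑ : ℕ → ringClassField K ι n) :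
    (¬ ∃ P : (W.baseChange (ringClassField K ι n)).toAffine.Point, (2 : ℤ) • P =
        ∑ g ∈ T, pointGalHom W (ringClassField K ι n) g d.y) ↔
      ¬ ∃ P : (W.baseChange (ringClassField K ι n)).toAffine.Point, (2 : ℤ) • P =
        ∑ g ∈ T, (∏ q ∈ Q, (if g (ϑ q) = ϑ q then (1 : ℤ) else -1)) • pointGalHom W (ringClassField K ι n) g d.y :=
  not_congr (heegner_exists_two_zsmul_eq_sum_iff_discrShadow T d.y Q ϑ)

/-! ## §4 Level one: `M₀ = 0` forces every genus Heegner point to be `2`-indivisible, hence of infinite order -/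

/-- **At conductor `1`: `P(1) ∉ 2E(K[1]) ⟺ y_{χ_Q} ∉ 2E(K[1])`** for every `Q` and radicals `ϑ`, where
`y_{χ_Q} := Σ_{g ∈ d₁.S} χ_Q(g) g·y(1)` is the genus Heegner point of `χ_Q` (`d₁.S = Gal(K[1]/K)`, `KolyvaginHeegnerData.mem_S_iff`).
[cite: GrossLMS1991, §4 (P_1 = Tr y_1 = y_K)] -/
theorem heegner_not_two_dvd_derivedPoint_one_iff_genusPoint (d₁ : KolyvaginHeegnerData Dt β ι 1) (Q : Finset ℕ)
    (ϑ : ℕ → ringClassField K ι 1) :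
    (¬ ∃ P : (W.baseChange (ringClassField K ι 1)).toAffine.Point, (2 : ℤ) • P = d₁.derivedPoint) ↔
      ¬ ∃ P : (W.baseChange (ringClassField K ι 1)).toAffine.Point, (2 : ℤ) • P =
        ∑ g ∈ d₁.S, (∏ q ∈ Q, (if g (ϑ q) = ϑ q then (1 : ℤ) else -1)) • pointGalHom W (ringClassField K ι 1) g d₁.y := by
  rw [d₁.derivedPoint_one]
  exact heegner_certificate_iff_discrShadow d₁ d₁.S Q ϑ

/-- **`M₀ = 0` ⟹ every genus Heegner point has infinite order.** On the habitat frame (`ρ̄_{E,2}` onto, `K` imaginary quadratic with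
odd `d_K` and the Heegner hypothesis, so that `E(K[1])` has no `2`-torsion — `heegner_two_torsion_free`): if `P(1) = y_K` is not
`2`-divisible in `E(K[1])`, then for EVERY finite set `Q` of primes and radicals `ϑ` the genus point `y_{χ_Q}` is not `2`-divisible and
is NOT of finite order. With `ϑ_q = √q*`, `q ∣ d_K` (§2), `y_{χ_Q}` is the Heegner datum of the genus pair `(E^{(Q*)}, E^{(Q* d_K)})`
(isotypy, §3); by Gross–Zagier for genus characters its non-torsion says that pair has analytic ranks exactly `{0,1}`. So the hypothesis
of `stub_levelOne` forces ALL `2^t` genus pairs of `(E, d_K)` to be of rank type `(0,1)` — the unconditional face of the BSD-side count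
`M₀ = ½·ord₂#Ш(E) + ½(DEF(E,K) − 1)` (U-LEDGER (♥)). [cite: GrossLMS1991, §4, Lemma 4.3] -/
theorem heegner_not_isOfFinAddOrder_genusPoint_of_not_two_dvd [W.IsElliptic] [W.IsGloballyMinimal]
    (hK : IsImaginaryQuadratic K) (hodd : Odd (NumberField.discr K)) (hH : SatisfiesHeegnerHypothesis (W.conductorNorm ℤ) K)
    (hsurj : W.HasSurjectiveModNGaloisRep ((2 : ℤ) ^ 1)) (d₁ : KolyvaginHeegnerData Dt β ι 1)
    (hM₀ : ¬ ∃ P : (W.baseChange (ringClassField K ι 1)).toAffine.Point, (2 : ℤ) • P = d₁.derivedPoint)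
    (Q : Finset ℕ) (ϑ : ℕ → ringClassField K ι 1) :
    (¬ ∃ P : (W.baseChange (ringClassField K ι 1)).toAffine.Point, (2 : ℤ) • P =
        ∑ g ∈ d₁.S, (∏ q ∈ Q, (if g (ϑ q) = ϑ q then (1 : ℤ) else -1)) • pointGalHom W (ringClassField K ι 1) g d₁.y) ∧
      ¬ IsOfFinAddOrder
        (∑ g ∈ d₁.S, (∏ q ∈ Q, (if g (ϑ q) = ϑ q then (1 : ℤ) else -1)) • pointGalHom W (ringClassField K ι 1) g d₁.y) := by
  have hndiv := (heegner_not_two_dvd_derivedPoint_one_iff_genusPoint d₁ Q ϑ).mp hM₀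
  exact ⟨hndiv, fun hfin ↦ hndiv (exists_two_smul_eq_of_isOfFinAddOrder
    (heegner_two_torsion_free (ι := ι) hK hodd hH hsurj one_ne_zero) hfin)⟩

/-! ## §5 Any level: a certificate forces every genus shadow to have infinite order -/

/-- **At any level `n ≥ 1`: a certificate `Z ∉ 2E(K[n])` forces EVERY genus shadow `Z_{χ_Q}` to be `2`-indivisible and of infinite
order** (habitat frame: `ρ̄_{E,2}` onto, odd `d_K`, Heegner hypothesis ⟹ `E(K[n])` has no `2`-torsion). For U this reads: if
`(n, d, θ, T)` certifies U for `(E, K)`, then for each of the `2^t` genus characters `χ_Q` of `K` the `χ_Q`-shadow — the `T`-trace of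
`y(n)` read on the genus twist `E^{(Q*)}` (§3 isotypy) — is a point of infinite order; by Gross–Zagier/Zhang for the characters
`χ_Q · ψ` (`ψ` ring class of conductor `n` trivial on `T`) a family of `2^t` first derivatives `L′(E^{(Q*)}/K, ψ, 1)` is non-zero.
An unconditional NECESSARY condition for U's certificate at level `n`. [cite: GrossLMS1991, §4, Lemma 4.3] -/
theorem heegner_not_isOfFinAddOrder_discrShadow_of_certificate [W.IsElliptic] [W.IsGloballyMinimal]
    (hK : IsImaginaryQuadratic K) (hodd : Odd (NumberField.discr K)) (hH : SatisfiesHeegnerHypothesis (W.conductorNorm ℤ) K)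
    (hsurj : W.HasSurjectiveModNGaloisRep ((2 : ℤ) ^ 1)) {n : ℕ} (hn : n ≠ 0) (d : KolyvaginHeegnerData Dt β ι n)
    (T : Finset (ringClassField K ι n ≃ₐ[ℚ] ringClassField K ι n))
    (hZ : ¬ ∃ P : (W.baseChange (ringClassField K ι n)).toAffine.Point, (2 : ℤ) • P =
      ∑ g ∈ T, pointGalHom W (ringClassField K ι n) g d.y)
    (Q : Finset ℕ) (ϑ : ℕ → ringClassField K ι n) :
    (¬ ∃ P : (W.baseChange (ringClassField K ι n)).toAffine.Point, (2 : ℤ) • P =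
        ∑ g ∈ T, (∏ q ∈ Q, (if g (ϑ q) = ϑ q then (1 : ℤ) else -1)) • pointGalHom W (ringClassField K ι n) g d.y) ∧
      ¬ IsOfFinAddOrder
        (∑ g ∈ T, (∏ q ∈ Q, (if g (ϑ q) = ϑ q then (1 : ℤ) else -1)) • pointGalHom W (ringClassField K ι n) g d.y) := by
  have hndiv := (heegner_certificate_iff_discrShadow d T Q ϑ).mp hZ
  exact ⟨hndiv, fun hfin ↦ hndiv (exists_two_smul_eq_of_isOfFinAddOrder
    (heegner_two_torsion_free (ι := ι) hK hodd hH hsurj hn) hfin)⟩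

/-- **U's conclusion ⟹ all genus shadows non-torsion, in U's own currency.** If U's conclusion holds for `(W, K, Dt, β, ι)` — some
square-free `n` of Kolyvagin primes at `2`, a datum `d`, conductor radicals `θ` and the genus stabiliser `T` with
`Σ_{g∈T} g·y(n) ∉ 2E(K[n])` — then (habitat frame) there is a level `n ≥ 1` at which, for every `Q` and discriminant radicals `ϑ`, the
`χ_Q`-shadow `Σ_{g∈T} χ_Q(g) g·y(n)` has infinite order. (`n ≠ 0` because `Squarefree n`.) [cite: GrossLMS1991, §4, Lemma 4.3] -/
theorem heegner_forall_discrShadow_not_isOfFinAddOrder_of_multiGenusCertificate [W.IsElliptic] [W.IsGloballyMinimal]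
    (hK : IsImaginaryQuadratic K) (hodd : Odd (NumberField.discr K)) (hH : SatisfiesHeegnerHypothesis (W.conductorNorm ℤ) K)
    (hsurj : W.HasSurjectiveModNGaloisRep ((2 : ℤ) ^ 1))
    (hU : ∃ (n : ℕ) (d : KolyvaginHeegnerData Dt β ι n) (θ : ℕ → ringClassField K ι n)
      (T : Finset (ringClassField K ι n ≃ₐ[ℚ] ringClassField K ι n)), Squarefree n ∧
      (∀ ℓ ∈ n.primeFactors, Zhang2014.IsKolyvaginPrime (W.conductorNorm ℤ) W K 2 ℓ) ∧
      (∀ ℓ ∈ n.primeFactors, θ ℓ ^ 2 = algebraMap ℚ (ringClassField K ι n) ((-1 : ℚ) ^ (ℓ / 2) * ℓ)) ∧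
      (∀ g, g ∈ T ↔ g ∈ ringClassGal ι n ∧ ∀ ℓ ∈ n.primeFactors, g (θ ℓ) = θ ℓ) ∧
      ¬ ∃ P : (W.baseChange (ringClassField K ι n)).toAffine.Point, (2 : ℤ) • P =
        ∑ g ∈ T, pointGalHom W (ringClassField K ι n) g d.y) :
    ∃ (n : ℕ) (d : KolyvaginHeegnerData Dt β ι n) (T : Finset (ringClassField K ι n ≃ₐ[ℚ] ringClassField K ι n)),
      n ≠ 0 ∧ (∀ g ∈ T, g ∈ ringClassGal ι n) ∧
      ∀ (Q : Finset ℕ) (ϑ : ℕ → ringClassField K ι n), ¬ IsOfFinAddOrder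
        (∑ g ∈ T, (∏ q ∈ Q, (if g (ϑ q) = ϑ q then (1 : ℤ) else -1)) • pointGalHom W (ringClassField K ι n) g d.y) := by
  obtain ⟨n, d, θ, T, hn, -, -, hT, hZ⟩ := hU
  exact ⟨n, d, T, hn.ne_zero, fun g hg ↦ ((hT g).mp hg).1, fun Q ϑ ↦
    (heegner_not_isOfFinAddOrder_discrShadow_of_certificate hK hodd hH hsurj hn.ne_zero d T hZ Q ϑ).2⟩

end Heegner

end Summit.BirchSwinnertonDyer.BirchSwinnertonDyer.Theorems.GenusKoly

end
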